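import Summits.ValiantsHypothesis.ValiantsHypothesis.Theorems.DualUnipotentThreeHalves.Negative.InflatedReturnsGeneral

/-!
# Rigid words in `U_{p,k}` for every even height `p` (val-idea-30 g3, MEMO rev 2 §4.3, λ = 1 and λ = 2)

Over ✓ p673673 `InflatedReturnsGeneral` (`Jp`, `Rp`, `infl p k A s = J_p ⊗ A + s·R_p ⊗ 1`, block vectors `bv`).
* λ = 1 (one edge `a → b`; `a = b`, a loop, is allowed by the statement): `T₁ = infl (E_ab) 0 = J⊗E_ab`, `T₀ = infl (E_ba) 1 = J⊗E_ba + R⊗1`, period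
  `W = (T₁T₀)^{(p−2)/2}·T₀` (`(p−2)/2` true letters, `p/2` false letters).  For EVEN `p ≥ 4`:
  `W (e₀ ⊗ f_a) = e₀ ⊗ f_a`, hence `W^j (e₀⊗f_a) = e₀⊗f_a ≠ 0` for all `j` — the walk of `e₀⊗f_a` under the letters is
  deterministic (R lifts block 0 to block p−2, then `T₁T₀` descends two blocks and returns `f_a`; R is met only at even blocks ≥ 2,
  where it vanishes) — so no cancellation can occur.  Consequence: a profile `(r,c,Θ)` taming `(T₀,T₁)` has `c·q ≤ r·(q+1)`,
  `q = (p−2)/2`, i.e. `ρ ≥ (p−2)/p`.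
* λ = 2 (path `a₀ → a₁ → a₂`): `T₁ = J⊗(E_{a₀a₁}+E_{a₁a₂})`, `T₀ = J⊗E_{a₂a₀} + R⊗1`, period `W₂ = (T₁T₁T₀)^{q}·T₀`, `q = (p−2)/3`
  (needs `3 ∣ p−2`): `W₂(e₀⊗f_{a₀}) = e₀⊗f_{a₀}`; forced ratio `ρ ≥ 2q/(q+1) = 2(p−2)/(p+1)`.
Finite linear algebra only; nothing here is R2, the crux, or VP ≠ VNP (NOT proved).
-/

set_option linter.dupNamespace false

noncomputable section

namespace Summit.ValiantsHypothesis.ValiantsHypothesis.Cruxes.DualUnipotentThreeHalves.RatioKnapsack.General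

open Matrix
open scoped Kronecker
open Summit.ValiantsHypothesis.ValiantsHypothesis.Theorems.DualUnipotentThreeHalvesNegative.InflatedReturnsGeneral

variable {p k : ℕ}

/-- `f_a = Pi.single a 1`. -/
abbrev f (a : Fin k) : Fin k → ℂ := Pi.single a 1

lemma single_mulVec_f (i j : Fin k) : single i j (1 : ℂ) *ᵥ f j = f i := by
  rw [single_mulVec_eq]; simp

/-- A pure climber `infl A 0 = J ⊗ A` moves block `α = β+1` to block `β`. -/
lemma infl_zero_bv (A : Matrix (Fin k) (Fin k) ℂ) (α β : Fin p) (h : (β : ℕ) + 1 = α) (x : Fin k → ℂ) :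
    infl p k A 0 *ᵥ bv p k α x = bv p k β (A *ᵥ x) := by
  rw [infl, zero_smul, add_zero, JA_bv_succ p k A α β h]

/-! ## λ = 1 -/
section lam1
variable (p k)

/-- `T₁ = J ⊗ E_ab`. -/
def T1 (a b : Fin k) : Matrix (ι p k) (ι p k) ℂ := infl p k (single a b 1) 0
/-- `T₀ = J ⊗ E_ba + R ⊗ 1`. -/
def T0 (a b : Fin k) : Matrix (ι p k) (ι p k) ℂ := infl p k (single b a 1) 1
/-- the period word `W = (T₁T₀)^{(p−2)/2} T₀`. -/
def W (a b : Fin k) : Matrix (ι p k) (ι p k) ℂ := (T1 p k a b * T0 p k a b) ^ ((p - 2) / 2) * T0 p k a b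

variable {p k}

/-- one round: `T₁T₀ (e_α ⊗ f_a) = e_{α−2} ⊗ f_a` for `α ≥ 2`. -/
lemma round_bv (a b : Fin k) (α γ : Fin p) (hα : (γ : ℕ) + 2 = α) :
    (T1 p k a b * T0 p k a b) *ᵥ bv p k α (f a) = bv p k γ (f a) := by
  rw [← mulVec_mulVec, T0, infl_mulVec_bv_two (single b a 1) 1 α ⟨(α : ℕ) - 1, by omega⟩ (by omega) (by simp; omega),
    single_mulVec_f, T1, infl_zero_bv (single a b 1) _ γ (by simp; omega), single_mulVec_f]

lemma rounds_bv (a b : Fin k) : ∀ (j : ℕ) (α γ : Fin p), (γ : ℕ) + 2 * j = α →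
    (T1 p k a b * T0 p k a b) ^ j *ᵥ bv p k α (f a) = bv p k γ (f a)
  | 0, α, γ, h => by
      have : γ = α := Fin.ext (by omega)
      rw [pow_zero, one_mulVec, this]
  | j + 1, α, γ, h => by
      rw [pow_succ, ← mulVec_mulVec, round_bv a b α ⟨(α : ℕ) - 2, by omega⟩ (by simp; omega)]
      exact rounds_bv a b j _ γ (by simp; omega)

/-- ★ **Rigid period (λ = 1, every even `p ≥ 4`)**: `W (e₀ ⊗ f_a) = e₀ ⊗ f_a`. -/
theorem W_bv_zero (hp : 4 ≤ p) (hev : Even p) (a b : Fin k) (z : Fin p) (hz : (z : ℕ) = 0) :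
    W p k a b *ᵥ bv p k z (f a) = bv p k z (f a) := by
  obtain ⟨t, ht⟩ := hev
  rw [W, ← mulVec_mulVec, T0, infl_mulVec_bv_zero (single b a 1) 1 z ⟨p - 2, by omega⟩ hz (by simp; omega), one_smul,
    ← T0, rounds_bv a b ((p - 2) / 2) _ z (by simp; omega)]

/-- hence every power of the period fixes `e₀ ⊗ f_a` … -/
theorem W_pow_bv_zero (hp : 4 ≤ p) (hev : Even p) (a b : Fin k) (z : Fin p) (hz : (z : ℕ) = 0) (j : ℕ) :
    W p k a b ^ j *ᵥ bv p k z (f a) = bv p k z (f a) := by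
  induction j with
  | zero => rw [pow_zero, one_mulVec]
  | succ j ih => rw [pow_succ, ← mulVec_mulVec, W_bv_zero hp hev a b z hz, ih]

lemma bv_f_ne_zero (a : Fin k) (z : Fin p) : bv p k z (f a) ≠ 0 := by
  intro h
  have := congr_fun h (z, a)
  simp [bv] at this

/-- ★ … and in particular `W^j ≠ 0` for all `j`: a nonzero word with `j(p−2)/2` true and `j·p/2` false letters. -/
theorem W_pow_ne_zero (hp : 4 ≤ p) (hev : Even p) (a b : Fin k) (j : ℕ) : W p k a b ^ j ≠ 0 := by
  intro h
  have := W_pow_bv_zero hp hev a b ⟨0, by omega⟩ rfl j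
  rw [h, zero_mulVec] at this
  exact bv_f_ne_zero a _ this.symm

end lam1

/-! ## λ = 2 -/
section lam2
variable (p k)

/-- `T₁ = J ⊗ (E_{a₀a₁} + E_{a₁a₂})`. -/
def T1' (a₀ a₁ a₂ : Fin k) : Matrix (ι p k) (ι p k) ℂ := infl p k (single a₀ a₁ 1 + single a₁ a₂ 1) 0
/-- `T₀ = J ⊗ E_{a₂a₀} + R ⊗ 1`. -/
def T0' (a₀ a₂ : Fin k) : Matrix (ι p k) (ι p k) ℂ := infl p k (single a₂ a₀ 1) 1
/-- the period word `W₂ = (T₁T₁T₀)^{(p−2)/3} T₀`. -/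
def W' (a₀ a₁ a₂ : Fin k) : Matrix (ι p k) (ι p k) ℂ :=
  (T1' p k a₀ a₁ a₂ * T1' p k a₀ a₁ a₂ * T0' p k a₀ a₂) ^ ((p - 2) / 3) * T0' p k a₀ a₂

variable {p k}

lemma climb_f (a₀ a₁ a₂ : Fin k) (h₁₂ : a₁ ≠ a₂) :
    (single a₀ a₁ (1 : ℂ) + single a₁ a₂ 1) *ᵥ f a₂ = f a₁ ∧ (single a₀ a₁ (1 : ℂ) + single a₁ a₂ 1) *ᵥ f a₁ = f a₀ := by
  constructor
  · rw [add_mulVec, single_mulVec_f, single_mulVec_eq]; simp [h₁₂]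
  · rw [add_mulVec, single_mulVec_f, single_mulVec_eq]; simp [Ne.symm h₁₂]

/-- one round: `T₁T₁T₀ (e_α ⊗ f_{a₀}) = e_{α−3} ⊗ f_{a₀}` for `α ≥ 3`. -/
lemma round_bv' (a₀ a₁ a₂ : Fin k) (h₁₂ : a₁ ≠ a₂) (α γ : Fin p) (hα : (γ : ℕ) + 3 = α) :
    (T1' p k a₀ a₁ a₂ * T1' p k a₀ a₁ a₂ * T0' p k a₀ a₂) *ᵥ bv p k α (f a₀) = bv p k γ (f a₀) := by
  obtain ⟨h1, h2⟩ := climb_f a₀ a₁ a₂ h₁₂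
  rw [← mulVec_mulVec, ← mulVec_mulVec, T0',
    infl_mulVec_bv_two (single a₂ a₀ 1) 1 α ⟨(α : ℕ) - 1, by omega⟩ (by omega) (by simp; omega), single_mulVec_f, T1',
    infl_zero_bv _ _ ⟨(α : ℕ) - 2, by omega⟩ (by simp; omega), h1, infl_zero_bv _ _ γ (by simp; omega), h2]

lemma rounds_bv' (a₀ a₁ a₂ : Fin k) (h₁₂ : a₁ ≠ a₂) : ∀ (j : ℕ) (α γ : Fin p), (γ : ℕ) + 3 * j = α →
    (T1' p k a₀ a₁ a₂ * T1' p k a₀ a₁ a₂ * T0' p k a₀ a₂) ^ j *ᵥ bv p k α (f a₀) = bv p k γ (f a₀)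
  | 0, α, γ, h => by
      have : γ = α := Fin.ext (by omega)
      rw [pow_zero, one_mulVec, this]
  | j + 1, α, γ, h => by
      rw [pow_succ, ← mulVec_mulVec, round_bv' a₀ a₁ a₂ h₁₂ α ⟨(α : ℕ) - 3, by omega⟩ (by simp; omega)]
      exact rounds_bv' a₀ a₁ a₂ h₁₂ j _ γ (by simp; omega)

/-- ★ **Rigid period (λ = 2, `p ≥ 5`, `3 ∣ p − 2`)**: `W₂ (e₀ ⊗ f_{a₀}) = e₀ ⊗ f_{a₀}`. -/
theorem W'_bv_zero (hp : 5 ≤ p) (h3 : 3 ∣ p - 2) (a₀ a₁ a₂ : Fin k) (h₁₂ : a₁ ≠ a₂)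
    (z : Fin p) (hz : (z : ℕ) = 0) : W' p k a₀ a₁ a₂ *ᵥ bv p k z (f a₀) = bv p k z (f a₀) := by
  obtain ⟨t, ht⟩ := h3
  rw [W', ← mulVec_mulVec, T0', infl_mulVec_bv_zero (single a₂ a₀ 1) 1 z ⟨p - 2, by omega⟩ hz (by simp; omega), one_smul,
    ← T0', rounds_bv' a₀ a₁ a₂ h₁₂ ((p - 2) / 3) _ z (by simp; omega)]

theorem W'_pow_ne_zero (hp : 5 ≤ p) (h3 : 3 ∣ p - 2) (a₀ a₁ a₂ : Fin k) (h₁₂ : a₁ ≠ a₂) (j : ℕ) :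
    W' p k a₀ a₁ a₂ ^ j ≠ 0 := by
  have key : ∀ j : ℕ, W' p k a₀ a₁ a₂ ^ j *ᵥ bv p k ⟨0, by omega⟩ (f a₀) = bv p k ⟨0, by omega⟩ (f a₀) := by
    intro j
    induction j with
    | zero => rw [pow_zero, one_mulVec]
    | succ j ih => rw [pow_succ, ← mulVec_mulVec, W'_bv_zero hp h3 a₀ a₁ a₂ h₁₂ _ rfl, ih]
  intro h
  have := key j
  rw [h, zero_mulVec] at this
  exact bv_f_ne_zero a₀ _ this.symm

end lam2

/-! ## The forced ratio -/

/-- If `c·(q·j) ≤ Θ + r·((q+1)·j)` for all `j` (the letter counts of the `j`-th power of a rigid period with `q` true and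
`q+1` false letters), then `c·q ≤ r·(q+1)`, i.e. `ρ = r/c ≥ q/(q+1)` (`= (p−2)/p` for λ = 1; for λ = 2 use `2q` true
letters: `c·2q ≤ r·(q+1)`). -/
theorem ratio_forced (q t r c Θ : ℕ) (h : ∀ j : ℕ, c * (t * j) ≤ Θ + r * ((q + 1) * j)) : c * t ≤ r * (q + 1) := by
  by_contra hc
  push Not at hc
  have := h (Θ + 1)
  nlinarith

end Summit.ValiantsHypothesis.ValiantsHypothesis.Cruxes.DualUnipotentThreeHalves.RatioKnapsack.General
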